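import Mathlib
import Summits.ValiantsHypothesis.ValiantsHypothesis.Theorems.NewtonUnitEquationsDissociatedUniformProductChart
import Summits.ValiantsHypothesis.ValiantsHypothesis.Theorems.NewtonUnitEquationsDissociatedUniformStubExposedGenericDirection
import Summits.ValiantsHypothesis.ValiantsHypothesis.Theorems.NewtonUnitEquationsDissociatedUniformStubTopSurvivorGreedy

/-!
# Theorem Q: a quasi-polynomial bound for Newton polygons on dissociated frames

**Theorem (`dissociated_quasiPoly`, = `QuasiPoly.vertex_bound`).**  Let `A : Fin m → Finset ℕ²` be a DISSOCIATED frame (the sum map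
`∏ j, A j → ℕ²` is injective) with `|A j| ≤ t`, and `f i j` (`i < k`, `j < m`) bivariate complex polynomials with
`supp (f i j) ⊆ A j`.  Then the Newton polygon of `F = Σ_i Π_j f i j` has at most
`(t + 2) · (8 (k + 2)³) ^ ⌈log₂ m⌉` vertices — polynomial in `t`, quasi-polynomial `(k+2)^O(log m)` in `(k, m)`.
(The crux `NewtonUnitEquations.DissociatedUniform`, stmt-ValiantsHypothesis-5905, asks for `(k·m·t + 2)^C`; the fixed-`k`
item 5907 gives `(m·t + 2)^(2k+3)`; the present bound is the better one as soon as `k ≫ log m`, and growth-wise it is still of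
KPTT-admissible size `2^O(√n · log² n)` in the transfer regime `k, t = 2^O(√n log n)`, `m = O(√n)` — the transfer itself
needs general, non-dissociated frames.)

Proof (line `greedy-basis-shadow`): every vertex is the point of a word that is lex-greedy for a generic direction
(stubs A `stub_exposedGenericDirection` and B `stub_topSurvivorGreedy`), i.e. lies in the frame SHADOW
`fshadow A f = cshadow (piFinset A) (col f) X Y`; splitting the coordinates `Fin (n₁ + n₂)` embeds the frame configuration
into the product of the two sub-frame configurations (Khatri–Rao columns multiply, points add), so by the product step
`s(n₁ + n₂) ≤ 2k²(k s(n₁) + k s(n₂) + 1) + 2k + 1`, and `s(1) ≤ t`; halving gives the bound.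
-/

set_option linter.dupNamespace false

namespace Summit.ValiantsHypothesis.ValiantsHypothesis.Theorems.NewtonUnitEquationsDissociatedUniform

open scoped BigOperators

namespace QuasiPoly

noncomputable section

variable {α β : Type} {k : ℕ}

/-- An embedding of configurations maps shadows into shadows. -/
theorem ncard_cshadow_le_of_embedding {γ : Type} (E : Finset α) (x : α → Fin k → ℂ) (X Y : α → ℝ)
    (E' : Finset γ) (x' : γ → Fin k → ℂ) (X' Y' : γ → ℝ) (φ : α → γ) (hφ : Function.Injective φ)
    (hE : ∀ c, c ∈ E' ↔ ∃ a ∈ E, φ a = c) (hx : ∀ a, x' (φ a) = x a) (hX : ∀ a, X' (φ a) = X a)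
    (hY : ∀ a, Y' (φ a) = Y a) :
    (cshadow E x X Y).ncard ≤ (cshadow E' x' X' Y').ncard := by
  have hlin : ∀ w a, lin X' Y' w (φ a) = lin X Y w a := by
    intro w a; simp only [lin, hX, hY]
  have himg : φ '' cshadow E x X Y ⊆ cshadow E' x' X' Y' := by
    rintro _ ⟨a, ⟨w, hinj, ha⟩, rfl⟩
    refine ⟨w, ?_, ?_⟩
    · intro c hc c' hc' h
      obtain ⟨b, hb, rfl⟩ := (hE c).mp hc
      obtain ⟨b', hb', rfl⟩ := (hE c').mp hc'
      rw [hlin, hlin] at h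
      rw [hinj hb hb' h]
    · refine ⟨(hE _).mpr ⟨a, ha.1, rfl⟩, fun hmem => ha.2 ?_⟩
      rw [hx] at hmem
      have hset : x' '' {e' : γ | e' ∈ E' ∧ lin X' Y' w (φ a) < lin X' Y' w e'} =
          x '' {e' : α | e' ∈ E ∧ lin X Y w a < lin X Y w e'} := by
        ext y
        constructor
        · rintro ⟨c, ⟨hc, hlt⟩, rfl⟩
          obtain ⟨b, hb, rfl⟩ := (hE c).mp hc
          rw [hlin, hlin] at hlt
          exact ⟨b, ⟨hb, hlt⟩, (hx b).symm⟩
        · rintro ⟨b, ⟨hb, hlt⟩, rfl⟩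
          refine ⟨φ b, ⟨(hE _).mpr ⟨b, hb, rfl⟩, ?_⟩, hx b⟩
          rw [hlin, hlin]; exact hlt
      rw [hset] at hmem
      exact hmem
  calc (cshadow E x X Y).ncard = (φ '' cshadow E x X Y).ncard := (Set.ncard_image_of_injective _ hφ).symm
    _ ≤ (cshadow E' x' X' Y').ncard := Set.ncard_le_ncard himg (cshadow_finite _ _ _ _)

/-! ## §D Frames -/

section Frames

/-- Khatri–Rao column of a word. -/
def col {k m : ℕ} (f : Fin k → Fin m → MvPolynomial (Fin 2) ℂ) (a : Fin m → (Fin 2 →₀ ℕ)) : Fin k → ℂ :=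
  fun i => ∏ j, (f i j).coeff (a j)

/-- First planar coordinate of the point of a word. -/
def Xf {m : ℕ} (a : Fin m → (Fin 2 →₀ ℕ)) : ℝ := (((∑ j, a j) (0 : Fin 2) : ℕ) : ℝ)

/-- Second planar coordinate of the point of a word. -/
def Yf {m : ℕ} (a : Fin m → (Fin 2 →₀ ℕ)) : ℝ := (((∑ j, a j) (1 : Fin 2) : ℕ) : ℝ)

/-- The frame shadow. -/
def fshadow {k m : ℕ} (A : Fin m → Finset (Fin 2 →₀ ℕ)) (f : Fin k → Fin m → MvPolynomial (Fin 2) ℂ) :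
    Set (Fin m → (Fin 2 →₀ ℕ)) :=
  cshadow (Fintype.piFinset A) (col f) Xf Yf

/-- The trivial bound: the shadow lies in the box. -/
theorem ncard_fshadow_le_pow {k m : ℕ} (t : ℕ) (A : Fin m → Finset (Fin 2 →₀ ℕ))
    (f : Fin k → Fin m → MvPolynomial (Fin 2) ℂ) (hcard : ∀ j, (A j).card ≤ t) :
    (fshadow A f).ncard ≤ t ^ m := by
  calc (fshadow A f).ncard ≤ ((Fintype.piFinset A : Finset _) : Set (Fin m → (Fin 2 →₀ ℕ))).ncard :=
        Set.ncard_le_ncard (cshadow_subset _ _ _ _) (Finset.finite_toSet _)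
    _ = (Fintype.piFinset A).card := Set.ncard_coe_finset _
    _ = ∏ j, (A j).card := Fintype.card_piFinset A
    _ ≤ t ^ m := by
        calc ∏ j, (A j).card ≤ ∏ _j : Fin m, t := Finset.prod_le_prod' fun j _ => hcard j
          _ = t ^ m := by simp

/-- **The splitting step.**  A frame on `Fin (n₁ + n₂)` embeds into the product of its two sub-frames. -/
theorem ncard_fshadow_add_le {k n₁ n₂ : ℕ} (A : Fin (n₁ + n₂) → Finset (Fin 2 →₀ ℕ))
    (f : Fin k → Fin (n₁ + n₂) → MvPolynomial (Fin 2) ℂ) :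
    (fshadow A f).ncard ≤
      2 * (k * k * (k * (fshadow (fun j => A (Fin.castAdd n₂ j)) (fun i j => f i (Fin.castAdd n₂ j))).ncard +
        k * (fshadow (fun j => A (Fin.natAdd n₁ j)) (fun i j => f i (Fin.natAdd n₁ j))).ncard + 1)) + k + k + 1 := by
  set AL : Fin n₁ → Finset (Fin 2 →₀ ℕ) := fun j => A (Fin.castAdd n₂ j) with hAL
  set AR : Fin n₂ → Finset (Fin 2 →₀ ℕ) := fun j => A (Fin.natAdd n₁ j) with hAR
  set fL : Fin k → Fin n₁ → MvPolynomial (Fin 2) ℂ := fun i j => f i (Fin.castAdd n₂ j) with hfL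
  set fR : Fin k → Fin n₂ → MvPolynomial (Fin 2) ℂ := fun i j => f i (Fin.natAdd n₁ j) with hfR
  -- the embedding `a ↦ (a_L, a_R)`
  set φ : (Fin (n₁ + n₂) → (Fin 2 →₀ ℕ)) → (Fin n₁ → (Fin 2 →₀ ℕ)) × (Fin n₂ → (Fin 2 →₀ ℕ)) :=
    fun a => (fun j => a (Fin.castAdd n₂ j), fun j => a (Fin.natAdd n₁ j)) with hφ
  have hφinj : Function.Injective φ := by
    intro a b hab
    have h1 : (fun j => a (Fin.castAdd n₂ j)) = fun j => b (Fin.castAdd n₂ j) := congrArg Prod.fst hab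
    have h2 : (fun j => a (Fin.natAdd n₁ j)) = fun j => b (Fin.natAdd n₁ j) := congrArg Prod.snd hab
    rw [← Fin.append_castAdd_natAdd (f := a), ← Fin.append_castAdd_natAdd (f := b), h1, h2]
  have hE : ∀ c, c ∈ Fintype.piFinset AL ×ˢ Fintype.piFinset AR ↔ ∃ a ∈ Fintype.piFinset A, φ a = c := by
    rintro ⟨b, c⟩
    simp only [Finset.mem_product, Fintype.mem_piFinset]
    constructor
    · rintro ⟨hb, hc⟩
      refine ⟨Fin.append b c, fun j => ?_, ?_⟩
      · refine Fin.addCases (fun j' => ?_) (fun j' => ?_) j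
        · rw [Fin.append_left]; exact hb j'
        · rw [Fin.append_right]; exact hc j'
      · simp only [hφ, Fin.append_left, Fin.append_right]
    · rintro ⟨a, ha, hac⟩
      simp only [hφ, Prod.mk.injEq] at hac
      obtain ⟨rfl, rfl⟩ := hac
      exact ⟨fun j => ha _, fun j => ha _⟩
  have hx : ∀ a, (fun p : (Fin n₁ → (Fin 2 →₀ ℕ)) × (Fin n₂ → (Fin 2 →₀ ℕ)) => col fL p.1 * col fR p.2) (φ a) =
      col f a := by
    intro a; funext i
    simp only [hφ, col, Pi.mul_apply, hfL, hfR]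
    rw [Fin.prod_univ_add]
  have hpt : ∀ a : Fin (n₁ + n₂) → (Fin 2 →₀ ℕ),
      ∑ j, a j = ∑ j, a (Fin.castAdd n₂ j) + ∑ j, a (Fin.natAdd n₁ j) := fun a => Fin.sum_univ_add _
  have hX : ∀ a, (fun p : (Fin n₁ → (Fin 2 →₀ ℕ)) × (Fin n₂ → (Fin 2 →₀ ℕ)) => Xf p.1 + Xf p.2) (φ a) = Xf a := by
    intro a
    simp only [hφ, Xf, hpt a, Finsupp.add_apply, Nat.cast_add]
  have hY : ∀ a, (fun p : (Fin n₁ → (Fin 2 →₀ ℕ)) × (Fin n₂ → (Fin 2 →₀ ℕ)) => Yf p.1 + Yf p.2) (φ a) = Yf a := by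
    intro a
    simp only [hφ, Yf, hpt a, Finsupp.add_apply, Nat.cast_add]
  calc (fshadow A f).ncard
      ≤ (cshadow (Fintype.piFinset AL ×ˢ Fintype.piFinset AR)
          (fun p : (Fin n₁ → (Fin 2 →₀ ℕ)) × (Fin n₂ → (Fin 2 →₀ ℕ)) => col fL p.1 * col fR p.2)
          (fun p => Xf p.1 + Xf p.2) (fun p => Yf p.1 + Yf p.2)).ncard :=
        ncard_cshadow_le_of_embedding _ _ _ _ _ _ _ _ φ hφinj hE hx hX hY
    _ ≤ 2 * (k * k * (k * (fshadow AL fL).ncard + k * (fshadow AR fR).ncard + 1)) + k + k + 1 :=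
        ncard_cshadow_prod_le _ _ _ _ _ _ _ _

/-- Elementary arithmetic of the recursion. -/
theorem recursion_arith (k t c s₁ s₂ : ℕ) (h₁ : s₁ ≤ (t + 2) * (8 * (k + 2) ^ 3) ^ c)
    (h₂ : s₂ ≤ (t + 2) * (8 * (k + 2) ^ 3) ^ c) :
    2 * (k * k * (k * s₁ + k * s₂ + 1)) + k + k + 1 ≤ (t + 2) * (8 * (k + 2) ^ 3) ^ (c + 1) := by
  set S := (t + 2) * (8 * (k + 2) ^ 3) ^ c with hS
  have hS1 : 1 ≤ S := by
    have : 1 ≤ (8 * (k + 2) ^ 3) ^ c := Nat.one_le_pow _ _ (by positivity)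
    calc 1 ≤ (t + 2) * 1 := by omega
      _ ≤ S := Nat.mul_le_mul_left _ this
  have hk : 4 * k ^ 3 + 2 * k ^ 2 + 2 * k + 1 ≤ 8 * (k + 2) ^ 3 := by nlinarith
  calc 2 * (k * k * (k * s₁ + k * s₂ + 1)) + k + k + 1
      ≤ 2 * (k * k * (k * S + k * S + 1)) + k + k + 1 := by gcongr
    _ = 4 * k ^ 3 * S + (2 * k ^ 2 + 2 * k + 1) := by ring
    _ ≤ 4 * k ^ 3 * S + (2 * k ^ 2 + 2 * k + 1) * S := by
        have := Nat.mul_le_mul_left (2 * k ^ 2 + 2 * k + 1) hS1; simpa using this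
    _ = (4 * k ^ 3 + 2 * k ^ 2 + 2 * k + 1) * S := by ring
    _ ≤ (8 * (k + 2) ^ 3) * S := Nat.mul_le_mul_right _ hk
    _ = (t + 2) * (8 * (k + 2) ^ 3) ^ (c + 1) := by rw [hS]; ring

/-- **The shadow bound.**  On every frame with `≤ t` letters per coordinate the shadow has at most
`(t + 2) · (8 (k+2)³)^⌈log₂ m⌉` words. -/
theorem ncard_fshadow_le : ∀ (m k t : ℕ) (A : Fin m → Finset (Fin 2 →₀ ℕ)) (f : Fin k → Fin m → MvPolynomial (Fin 2) ℂ),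
    (∀ j, (A j).card ≤ t) → (fshadow A f).ncard ≤ (t + 2) * (8 * (k + 2) ^ 3) ^ Nat.clog 2 m := by
  intro m
  induction m using Nat.strong_induction_on with
  | _ m ih =>
    intro k t A f hcard
    have hβ : 1 ≤ (8 * (k + 2) ^ 3) ^ Nat.clog 2 m := Nat.one_le_pow _ _ (by positivity)
    rcases Nat.lt_or_ge m 2 with hm | hm
    · -- `m ≤ 1`: the box itself is small
      have h := ncard_fshadow_le_pow t A f hcard
      have htm : t ^ m ≤ t + 2 := by
        interval_cases m <;> simp
      calc (fshadow A f).ncard ≤ t + 2 := h.trans htm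
        _ = (t + 2) * 1 := (mul_one _).symm
        _ ≤ (t + 2) * (8 * (k + 2) ^ 3) ^ Nat.clog 2 m := Nat.mul_le_mul_left _ hβ
    · obtain ⟨n₁, n₂, hmn, hn₁, hn₂, hc₁, hc₂⟩ : ∃ n₁ n₂ : ℕ, m = n₁ + n₂ ∧ n₁ < m ∧ n₂ < m ∧
          Nat.clog 2 n₁ + 1 = Nat.clog 2 m ∧ Nat.clog 2 n₂ + 1 ≤ Nat.clog 2 m := by
        refine ⟨(m + 1) / 2, m / 2, by omega, by omega, by omega, ?_, ?_⟩
        · have h := Nat.clog_of_two_le (b := 2) one_lt_two hm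
          have : (m + 2 - 1) / 2 = (m + 1) / 2 := by omega
          rw [this] at h; omega
        · have h := Nat.clog_of_two_le (b := 2) one_lt_two hm
          have : (m + 2 - 1) / 2 = (m + 1) / 2 := by omega
          rw [this] at h
          have hmono := Nat.clog_mono_right 2 (show m / 2 ≤ (m + 1) / 2 by omega)
          omega
      subst hmn
      have hL := ih n₁ hn₁ k t (fun j => A (Fin.castAdd n₂ j)) (fun i j => f i (Fin.castAdd n₂ j)) fun j => hcard _
      have hR := ih n₂ hn₂ k t (fun j => A (Fin.natAdd n₁ j)) (fun i j => f i (Fin.natAdd n₁ j)) fun j => hcard _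
      set c := Nat.clog 2 (n₁ + n₂) with hc
      have hL' : (fshadow (fun j => A (Fin.castAdd n₂ j)) (fun i j => f i (Fin.castAdd n₂ j))).ncard ≤
          (t + 2) * (8 * (k + 2) ^ 3) ^ (c - 1) :=
        hL.trans (Nat.mul_le_mul_left _ (Nat.pow_le_pow_right (by positivity) (by omega)))
      have hR' : (fshadow (fun j => A (Fin.natAdd n₁ j)) (fun i j => f i (Fin.natAdd n₁ j))).ncard ≤
          (t + 2) * (8 * (k + 2) ^ 3) ^ (c - 1) :=
        hR.trans (Nat.mul_le_mul_left _ (Nat.pow_le_pow_right (by positivity) (by omega)))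
      have hstep := ncard_fshadow_add_le A f
      have harith := recursion_arith k t (c - 1) _ _ hL' hR'
      have hc1 : c - 1 + 1 = c := by omega
      rw [hc1] at harith
      exact hstep.trans harith

/-! ## §E Vertices are shadow points (stubs A and B) and the quasi-polynomial bound -/

/-- Every vertex of the Newton polygon of `F = Σ_i Π_j f_ij` on a dissociated frame is the point of a word of the
frame shadow. -/
theorem extremePoints_subset_image_fshadow {k m : ℕ} (A : Fin m → Finset (Fin 2 →₀ ℕ))
    (f : Fin k → Fin m → MvPolynomial (Fin 2) ℂ) (hsupp : ∀ i j, (f i j).support ⊆ A j)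
    (hdis : ∀ a b : Fin m → (Fin 2 →₀ ℕ), (∀ j, a j ∈ A j) → (∀ j, b j ∈ A j) → ∑ j, a j = ∑ j, b j → a = b) :
    Set.extremePoints ℝ (convexHull ℝ ((fun e : Fin 2 →₀ ℕ => fun i : Fin 2 => ((e i : ℕ) : ℝ)) ''
      ((∑ i, ∏ j, f i j).support : Set (Fin 2 →₀ ℕ)))) ⊆
      (fun a : Fin m → (Fin 2 →₀ ℕ) => fun i : Fin 2 => (((∑ j, a j) i : ℕ) : ℝ)) '' fshadow A f := by
  classical
  intro V hV
  obtain ⟨w, e₀, he₀, hVe, hmax, hinjT⟩ := stub_exposedGenericDirection (∑ i, ∏ j, f i j).support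
    ((Fintype.piFinset A).image fun a => ∑ j, a j) V hV
  obtain ⟨a₀, ha₀, hpt, hgr⟩ := stub_topSurvivorGreedy k m A f w e₀ hsupp hdis he₀ hmax
  refine ⟨a₀, ?_, by rw [← hVe, ← hpt]⟩
  -- the height of B is the planar height `lin Xf Yf w`
  have hheight : (fun a : Fin m → (Fin 2 →₀ ℕ) => ∑ i, w i * ((((∑ j, a j) i : ℕ) : ℝ))) = lin Xf Yf w := by
    funext a; simp only [lin, Xf, Yf, Fin.sum_univ_two]
  refine ⟨w, ?_, ?_⟩
  · -- injectivity on the box from injectivity on the points and dissociation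
    intro a ha b hb hab
    have ha' := Fintype.mem_piFinset.mp (Finset.mem_coe.mp ha)
    have hb' := Fintype.mem_piFinset.mp (Finset.mem_coe.mp hb)
    rw [← hheight] at hab
    have hTa : (∑ j, a j) ∈ (((Fintype.piFinset A).image fun a => ∑ j, a j : Finset _) : Set (Fin 2 →₀ ℕ)) :=
      Finset.mem_coe.mpr (Finset.mem_image.mpr ⟨a, Finset.mem_coe.mp ha, rfl⟩)
    have hTb : (∑ j, b j) ∈ (((Fintype.piFinset A).image fun a => ∑ j, a j : Finset _) : Set (Fin 2 →₀ ℕ)) :=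
      Finset.mem_coe.mpr (Finset.mem_image.mpr ⟨b, Finset.mem_coe.mp hb, rfl⟩)
    exact hdis a b ha' hb' (hinjT hTa hTb hab)
  · -- greediness: B's conclusion is membership in `gE (piFinset A) (col f) (lin Xf Yf w)`
    have hgr' : a₀ ∈ gE (Fintype.piFinset A) (col f)
        (fun a : Fin m → (Fin 2 →₀ ℕ) => ∑ i, w i * ((((∑ j, a j) i : ℕ) : ℝ))) := hgr
    rw [hheight] at hgr'
    exact hgr'

/-- **Theorem Q.**  On a dissociated frame with `≤ t` letters per coordinate, the Newton polygon of
`Σ_{i<k} Π_{j<m} f_ij` has at most `(t + 2) · (8 (k + 2)³)^⌈log₂ m⌉` vertices — quasi-polynomial in `(k, m, t)`. -/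
theorem vertex_bound (k m t : ℕ) (A : Fin m → Finset (Fin 2 →₀ ℕ))
    (f : Fin k → Fin m → MvPolynomial (Fin 2) ℂ) (hcard : ∀ j, (A j).card ≤ t)
    (hsupp : ∀ i j, (f i j).support ⊆ A j)
    (hdis : ∀ a b : Fin m → (Fin 2 →₀ ℕ), (∀ j, a j ∈ A j) → (∀ j, b j ∈ A j) → ∑ j, a j = ∑ j, b j → a = b) :
    (Set.extremePoints ℝ (convexHull ℝ ((fun e : Fin 2 →₀ ℕ => fun i : Fin 2 => ((e i : ℕ) : ℝ)) ''
      ((∑ i, ∏ j, f i j).support : Set (Fin 2 →₀ ℕ))))).ncard ≤ (t + 2) * (8 * (k + 2) ^ 3) ^ Nat.clog 2 m := by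
  calc (Set.extremePoints ℝ (convexHull ℝ ((fun e : Fin 2 →₀ ℕ => fun i : Fin 2 => ((e i : ℕ) : ℝ)) ''
      ((∑ i, ∏ j, f i j).support : Set (Fin 2 →₀ ℕ))))).ncard
      ≤ ((fun a : Fin m → (Fin 2 →₀ ℕ) => fun i : Fin 2 => (((∑ j, a j) i : ℕ) : ℝ)) '' fshadow A f).ncard :=
        Set.ncard_le_ncard (extremePoints_subset_image_fshadow A f hsupp hdis)
          ((cshadow_finite _ _ _ _).image _)
    _ ≤ (fshadow A f).ncard := Set.ncard_image_le (cshadow_finite _ _ _ _)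
    _ ≤ (t + 2) * (8 * (k + 2) ^ 3) ^ Nat.clog 2 m := ncard_fshadow_le m k t A f hcard

end Frames

end

end QuasiPoly

/-- **Theorem Q (definition-free export).**  On a dissociated frame with `≤ t` letters per coordinate, the Newton polygon
of `Σ_{i<k} Π_{j<m} f_ij` has at most `(t + 2) · (8 (k + 2)³)^⌈log₂ m⌉` vertices. -/
theorem dissociated_quasiPoly (k m t : ℕ) (A : Fin m → Finset (Fin 2 →₀ ℕ))
    (f : Fin k → Fin m → MvPolynomial (Fin 2) ℂ) (hcard : ∀ j, (A j).card ≤ t)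
    (hsupp : ∀ i j, (f i j).support ⊆ A j)
    (hdis : ∀ a b : Fin m → (Fin 2 →₀ ℕ), (∀ j, a j ∈ A j) → (∀ j, b j ∈ A j) → ∑ j, a j = ∑ j, b j → a = b) :
    (Set.extremePoints ℝ (convexHull ℝ ((fun e : Fin 2 →₀ ℕ => fun i : Fin 2 => ((e i : ℕ) : ℝ)) ''
      ((∑ i, ∏ j, f i j).support : Set (Fin 2 →₀ ℕ))))).ncard ≤ (t + 2) * (8 * (k + 2) ^ 3) ^ Nat.clog 2 m :=
  QuasiPoly.vertex_bound k m t A f hcard hsupp hdis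

/-- **Theorem Q in the shape of the crux.**  On a dissociated frame the crux's bound `(k·m·t + 2)^C` holds with the
exponent `C = 5·⌈log₂ m⌉ + 1` (logarithmic in `m` instead of constant):
`#vert ≤ (k·m·t + 2)^(5⌈log₂ m⌉ + 1)`.  (From `dissociated_quasiPoly`: for `k, m, t ≥ 1` one has `t + 2 ≤ kmt + 2` and
`8(k+2)³ ≤ (kmt+2)⁵`; if `k = 0` or `t = 0 < m` the polynomial vanishes, and for `m = 0` it is constant.) -/
theorem dissociated_logExponent (k m t : ℕ) (A : Fin m → Finset (Fin 2 →₀ ℕ))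
    (f : Fin k → Fin m → MvPolynomial (Fin 2) ℂ) (hcard : ∀ j, (A j).card ≤ t)
    (hsupp : ∀ i j, (f i j).support ⊆ A j)
    (hdis : ∀ a b : Fin m → (Fin 2 →₀ ℕ), (∀ j, a j ∈ A j) → (∀ j, b j ∈ A j) → ∑ j, a j = ∑ j, b j → a = b) :
    (Set.extremePoints ℝ (convexHull ℝ ((fun e : Fin 2 →₀ ℕ => fun i : Fin 2 => ((e i : ℕ) : ℝ)) ''
      ((∑ i, ∏ j, f i j).support : Set (Fin 2 →₀ ℕ))))).ncard ≤ (k * m * t + 2) ^ (5 * Nat.clog 2 m + 1) := by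
  classical
  have hQ := dissociated_quasiPoly k m t A f hcard hsupp hdis
  -- the vanishing cases: `k = 0`, or `t = 0 < m`
  have hzero : (∑ i, ∏ j, f i j) = 0 →
      (Set.extremePoints ℝ (convexHull ℝ ((fun e : Fin 2 →₀ ℕ => fun i : Fin 2 => ((e i : ℕ) : ℝ)) ''
        ((∑ i, ∏ j, f i j).support : Set (Fin 2 →₀ ℕ))))).ncard ≤ (k * m * t + 2) ^ (5 * Nat.clog 2 m + 1) := by
    intro h
    have hE : Set.extremePoints ℝ (convexHull ℝ ((fun e : Fin 2 →₀ ℕ => fun i : Fin 2 => ((e i : ℕ) : ℝ)) ''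
        ((∑ i, ∏ j, f i j).support : Set (Fin 2 →₀ ℕ)))) = ∅ := by
      apply Set.subset_empty_iff.mp
      intro e he
      have := extremePoints_convexHull_subset he
      simp [h] at this
    rw [hE, Set.ncard_empty]
    exact Nat.zero_le _
  rcases Nat.eq_zero_or_pos k with rfl | hk
  · exact hzero (by simp)
  rcases Nat.eq_zero_or_pos m with rfl | hm
  · -- `m = 0`: the bound of Theorem Q is `t + 2`, but there is at most one support point
    have hsub : ((∑ i : Fin k, ∏ j : Fin 0, f i j).support : Set (Fin 2 →₀ ℕ)) ⊆ {0} := by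
      intro e he
      have h1 : (∑ i : Fin k, ∏ j : Fin 0, f i j) = MvPolynomial.C (k : ℂ) := by simp
      rw [Finset.mem_coe, h1, MvPolynomial.mem_support_iff, MvPolynomial.coeff_C] at he
      by_contra hne
      have h0e : (0 : Fin 2 →₀ ℕ) ≠ e := fun h => hne (by rw [← h]; exact Set.mem_singleton _)
      rw [if_neg h0e] at he
      exact he rfl
    calc _ ≤ ((fun e : Fin 2 →₀ ℕ => fun i : Fin 2 => ((e i : ℕ) : ℝ)) ''
          ((∑ i : Fin k, ∏ j : Fin 0, f i j).support : Set (Fin 2 →₀ ℕ))).ncard :=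
          Set.ncard_le_ncard extremePoints_convexHull_subset ((Finset.finite_toSet _).image _)
      _ ≤ ((∑ i : Fin k, ∏ j : Fin 0, f i j).support : Set (Fin 2 →₀ ℕ)).ncard := Set.ncard_image_le (Finset.finite_toSet _)
      _ ≤ ({0} : Set (Fin 2 →₀ ℕ)).ncard := Set.ncard_le_ncard hsub (Set.finite_singleton _)
      _ = 1 := Set.ncard_singleton _
      _ ≤ (k * 0 * t + 2) ^ (5 * Nat.clog 2 0 + 1) := Nat.one_le_pow _ _ (by omega)
  rcases Nat.eq_zero_or_pos t with rfl | ht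
  · -- `t = 0 < m`: `A ⟨0, hm⟩ = ∅`, so `f i ⟨0, hm⟩ = 0` and the polynomial vanishes
    apply hzero
    have hj : A ⟨0, hm⟩ = ∅ := Finset.card_eq_zero.mp (Nat.le_zero.mp (hcard ⟨0, hm⟩))
    have hf : ∀ i, f i ⟨0, hm⟩ = 0 := by
      intro i
      have := hsupp i ⟨0, hm⟩
      rw [hj, Finset.subset_empty, MvPolynomial.support_eq_empty] at this
      exact this
    refine Finset.sum_eq_zero fun i _ => ?_
    exact Finset.prod_eq_zero (Finset.mem_univ (⟨0, hm⟩ : Fin m)) (hf i)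
  -- the main case `k, m, t ≥ 1`
  set x := k * m * t + 2 with hx
  have hx3 : 3 ≤ x := by
    have : 1 ≤ k * m * t := Nat.mul_pos (Nat.mul_pos hk hm) ht
    omega
  have ht2 : t + 2 ≤ x := by
    have : t ≤ k * m * t := by
      calc t = 1 * 1 * t := by ring
        _ ≤ k * m * t := Nat.mul_le_mul (Nat.mul_le_mul hk hm) le_rfl
    omega
  have hk2 : k + 2 ≤ x := by
    have : k ≤ k * m * t := by
      calc k = k * 1 * 1 := by ring
        _ ≤ k * m * t := Nat.mul_le_mul (Nat.mul_le_mul le_rfl hm) ht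
    omega
  have hβ : 8 * (k + 2) ^ 3 ≤ x ^ 5 := by
    have h8 : 8 ≤ x ^ 2 := by nlinarith
    calc 8 * (k + 2) ^ 3 ≤ x ^ 2 * x ^ 3 := Nat.mul_le_mul h8 (Nat.pow_le_pow_left hk2 3)
      _ = x ^ 5 := by ring
  calc _ ≤ (t + 2) * (8 * (k + 2) ^ 3) ^ Nat.clog 2 m := hQ
    _ ≤ x * (x ^ 5) ^ Nat.clog 2 m := Nat.mul_le_mul ht2 (Nat.pow_le_pow_left hβ _)
    _ = x ^ (5 * Nat.clog 2 m + 1) := by rw [← pow_mul]; ring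


end Summit.ValiantsHypothesis.ValiantsHypothesis.Theorems.NewtonUnitEquationsDissociatedUniform
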